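import Mathlib
import HarnessLib
import Literature.AlgebraicGeometry.Resolution.AlterationsStrong
import Summits.ResolutionOfSingularities.ResolutionOfSingularities.Theorems.WildQuotientsWildQuotientResolutionS1aKillMeasure

/-!
# S1a — THE KILL-CENTRE RULE: the residual of the termination crux, and `Wins` of the initial model from it

[OURS · L1 W4.5c · lead-1 g7; CHAIN v10.3 §4 row `stub_winningStrategy`, STRATEGY-DESIGN v2 (R0)] — NOT statements of the manuscript;
counted 0; AI-level work, weaker than expert review. Crux stmt-ResolutionOfSingularities-17941, line `s1a-logminvertex` v6. Route-independent
(no `Theses` import); the `WinningStrategy` wrapper is `…S1aWinsOfKillRule`.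

* **`KillCentreRule p`** (OURS CANDIDATE, the RESIDUAL of the crux — asserted nowhere, consumed only as a hypothesis): every non-terminal
  `G`-model (`G = ⟨g₀⟩` finite) of finite type over a Noetherian affine base fixed by `G` admits a KILL centre (`NodeAtlas.IsKillCentre`:
  centre charts satisfying the one-shot kill hypotheses) whose kill-centre charts meet every irreducible component of the bad locus —
  the (R0) centre rule of STRATEGY-DESIGN v2 as an EXISTENCE statement (its truth is the research question: MUFALS / T2-FALSIFIER-SPEC).
* `GameFrame.GModel.hasNoetherianBase_of_datum` — every model of a datum over a field is of finite type over `Spec k`.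
* **`wins_initial_of_killCentreRule`** — the rule makes the initial model of every `CyclicQuotientFourfolds`-type datum WIN
  (`GModel.wins_of_killCentres`, induction on `ν₁`; `ν₁ < ∞` by `exists_topologicalKrullDim_le_of_locallyOfFiniteType`).
-/

set_option linter.dupNamespace false

noncomputable section

open CategoryTheory Limits AlgebraicGeometry TopologicalSpace
open Literature.AlgebraicGeometry.Resolution Literature.AlgebraicGeometry.RelativeSpec
open Summit.ResolutionOfSingularities.ResolutionOfSingularities.Theorems.WildQuotientResolution.S1
open Summit.ResolutionOfSingularities.ResolutionOfSingularities.Theorems.WildQuotientResolution.S1.NodeAtlas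
open Summit.ResolutionOfSingularities.ResolutionOfSingularities.Theorems.WildQuotientResolution.S1.GameFrame

namespace Summit.ResolutionOfSingularities.ResolutionOfSingularities.Theorems.WildQuotientResolution.S1

/-- **THE KILL-CENTRE RULE at the prime `p`** [OURS · L1 W4.5c — CANDIDATE, the residual of `stub_winningStrategy`; replaces the role of
the termination argument; NOT a statement of the manuscript, NOT asserted]: for every action datum `(q : X' → X₁, ρ : G → Aut X')`
with `G = ⟨g₀⟩` finite and every `G`-model `M` of it (tree `GameFrame.GModel`: proper birational, node atlas) which is of finite type
over a Noetherian affine base fixed by `G` and NOT terminal, there is a KILL centre `(𝒦, d)` (`NodeAtlas.IsKillCentre`) whose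
kill-centre charts meet every irreducible component of the bad locus `Z(M)`. -/
def KillCentreRule (p : ℕ) : Prop :=
  ∀ ⦃X' X₁ : Scheme.{0}⦄ (q : X' ⟶ X₁) (G : Type) [Group G] [Finite G] (ρ : G →* Aut X') (g₀ : G),
    (∀ g : G, g ∈ Subgroup.zpowers g₀) →
    ∀ M : GModel p q G ρ g₀, M.HasNoetherianBase → ¬ M.Terminal →
      ∃ (𝒦 : ReesFiltration M.V) (d : ℕ), IsKillCentre p M.act g₀ 𝒦 d ∧
        ∀ t ∈ irreducibleComponents ↥M.badLocus, ∃ x ∈ t, (x : M.V) ∈ M.killOpen 𝒦 d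

namespace GameFrame.GModel

variable {p : ℕ} {X' X₁ : Scheme.{0}} {q : X' ⟶ X₁} {G : Type} [Group G] {ρ : G →* Aut X'} {g₀ : G}

/-- Every model of a datum over a field `k` (`f : X₁ → Spec k` locally of finite type, `q` finite) is of finite type over the
Noetherian base `Spec k`, on which `G` acts trivially. -/
theorem hasNoetherianBase_of_datum {k : Type} [Field k] (f : X₁ ⟶ Spec (.of k)) [LocallyOfFiniteType f] [IsFinite q]
    (M : GModel p q G ρ g₀) : M.HasNoetherianBase := by
  haveI := M.isProper
  have hr : M.r = M.π ≫ q := M.r_eq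
  haveI : LocallyOfFiniteType M.r := by rw [hr]; infer_instance
  exact ⟨k, inferInstance, inferInstance, M.r ≫ f, inferInstance, fun g => by rw [← Category.assoc, M.act.aut_comp g]⟩

/-- **The kill-centre rule makes the initial model win.** [OURS · L1 W4.5c] -/
theorem wins_initial_of_killCentreRule (hp : p.Prime) (hrule : KillCentreRule p) {k : Type} [Field k] (f : X₁ ⟶ Spec (.of k))
    [LocallyOfFiniteType f] [QuasiCompact f] [IsFinite q] [Finite G] (hG : ∀ g : G, g ∈ Subgroup.zpowers g₀)
    (hq : ∀ g : G, (ρ g).hom ≫ q = q) [IsIntegral X'] [IsLocallyNoetherian X'] (h₀ : NodeAtlas p (⟨ρ, hq⟩ : ActionOver q G) g₀) :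
    Wins p q G ρ g₀ (GModel.initial hq h₀) := by
  -- the initial model has finite `ν₁`
  haveI : CompactSpace X' := by
    haveI : QuasiCompact (q ≫ f) := inferInstance
    exact (HasAffineProperty.iff_of_isAffine (P := @QuasiCompact)).mp this
  obtain ⟨n, hn⟩ := exists_topologicalKrullDim_le_of_locallyOfFiniteType (q ≫ f)
  have hn₀ : (GModel.initial (p := p) (g₀ := g₀) hq h₀).nu1 < (n + 1 : ℕ) := by
    refine lt_of_le_of_lt ((GModel.initial hq h₀).nu1_le.trans hn) ?_
    exact_mod_cast Nat.lt_succ_self n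
  refine wins_of_killCentres hp hG (fun _ => True) (fun M _ hB hT => ?_) (GModel.initial hq h₀) trivial
    (hasNoetherianBase_of_datum f _) hn₀
  obtain ⟨𝒦, d, hkill, hhit⟩ := hrule q G ρ g₀ hG M hB hT
  exact ⟨𝒦, d, hkill, hhit, fun M' _ => ⟨trivial, hasNoetherianBase_of_datum f M'⟩⟩

end GameFrame.GModel

end Summit.ResolutionOfSingularities.ResolutionOfSingularities.Theorems.WildQuotientResolution.S1

end
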